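import Mathlib
import Literature.Analysis.FluidPDE.SawtoothCascade

/-!
# K2 — the TYPED SLOT MAP of the sharp cascade (one slot, one line family)

planner ad-ideate-p4 gen 15 (lens «control», service F-p4g15-1), crux workfile on the dir of
stmt-AnomalousDissipation-19491; companion of `K2MaterialControl.md` §1 (structure fact S-1 … S-5) and of
`K2ControlSketch.lean` (§5 `khField`/`khForm`, §6 material duality, budget algebra).  Asked for by the K2
prover lane (ad-k1loc-p2 g9, `K2SheetBlockPropagator.md` §4(b): "the slot OPERATOR norm … prerequisite: a TYPED
slot map (p4) — the present files type only the block") and by the arbiter (A25-11′ S2-cert, forced part).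

MODEL (sharp: `δ₀ = 0`, `ν = 0`, linearised about the cascade field, one H slot of total strain `θ` at a level
whose period has been rescaled to 1).  The shear is `u = (θ̇ · triWave y, 0)`, its vorticity `Ω = -triWave′(y) = ∓1`
is piecewise constant with jumps on the two KINK LINES `y = ± 1/4`.  The linearised vorticity equation
`∂ₜζ + U ∂ₓζ = -v′ ∂_y Ω` therefore (S-1/S-2 of the memo):
* transports whatever vorticity is present (`ζ ↦ ζ ∘ Φ_θ⁻¹`, i.e. the streamwise Fourier mode `e^{2πiax} ζ₀(y)`
  picks up the phase `e^{-2πiaθ·triWave y}` — `transportPhase`), and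
* creates a FRESH SHEET PAIR `q₊ δ(y - 1/4) + q₋ δ(y + 1/4)` (times `e^{2πiax}`) whose amplitudes solve the
  2 × 2 Kelvin–Helmholtz block ODE `q′ = X q + f(s)` (`blockX`; the tree's `khField` up to the Bloch-sign
  convention, see `KernelAtHalf`), forced by the transverse velocity that the transported content induces on
  the kink lines (`forcing`, through the periodised line kernel `lineKernel`), solved by Duhamel with the
  EXPLICIT propagator `P(t) = C(t)·1 + Sn(t)·X` of p2's `sheet_solution_eq` (`propagator`).
Streamwise wavenumber `a` and transverse Bloch phase `β` are preserved by the slot, so the slot map is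
block-diagonal over LINE FAMILIES `{(a, β + n) : n ∈ ℤ}`; this file types ONE family.  The state on a family is a
LAMINATION STATE (S-4): an interior density profile on one period plus finitely many sheets (position,
amplitude).  Energy = `Σ_n |ζ̂(β+n)|² / (4π² (a² + (β+n)²))` (`energy`).

CONVENTIONS = those of the seat's validated engine `wo_p4_k2_3.py` (`line_block_split`), which reproduces
p2's independent block norms (13.62 ↔ 13.627) and g14's `k2lib.py`: quasi-periodicity `ζ(y+1) = e^{2πiβ} ζ(y)`,
modes `e^{2πi(β+n)y}`, kernel `lineKernel a β y = Σ_n e^{2πiβn} g(y-n)`, `g(y) = -e^{-2π|a||y|}/(4π|a|)`.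
With these, `2π · lineKernel a β 0 = sawSigma0 a β` and `2π · conj (lineKernel a β (1/2)) = sawS a β`
(`KernelAtZero`, `KernelAtHalf` — stated, not proved here), and `blockX² = -(a² · sawC2 a β) • 1` (`BlockSq`;
p2's `khBlock_sq`).

WHAT IS TYPED HERE: definitions `lineKernel`, `transportPhase`, `blockX`, `khLam`, `propC`, `propSn`,
`propagator`, `LamState`, `forcing`, `sheetAmps`, `slotMap`, `coeff`, `energy`; statements (Props, no proofs,
no sorry): `KernelAtZero`, `KernelAtHalf`, `BlockSq`, `PropagatorODE`, `SlotEnergyAmp` (one-family slot norm),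
`SlotNormClass` (the arbiter's "slot norm ≤ B per class"), `CombEventP3` (memo §3 P3: continuum value
14.436 ± 0.006, kit j320829), `FreshPairNextSlotAmp` (memo §2 G, one streamwise wavenumber of a fresh pair into
the next slot of the other orientation: ≤ 13.6 measured for KH-band `a`, K = 24/32).
WHAT IS NOT: the identification of `slotMap` with the PDE objects of `K2PhaseGrowthClassicalH` (smooth field,
`δ_j > 0`, `ν > 0`) is the memo's S-2 and is INFORMAL here; the two-dimensional PHASE map (H slot, then V slot on
the transposed families, then children re-framing) behind P1′ is not typed in this file (it is the composition of
this one-family map over the families `b = β + n` with the roles of the coordinates exchanged — see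
`FreshPairNextSlotAmp` for the pattern).  Nothing here is a theorem; every `def … : Prop` is a target.
-/

namespace Summit.AnomalousDissipation.AnomalousDissipation.Cruxes.K1LocalisedCascade.K2SlotMap

open Complex MeasureTheory intervalIntegral
open Literature.Analysis.FluidPDE.SawtoothCascade

noncomputable section

/-! ## 1. Kernel, transport phase, Kelvin–Helmholtz block, explicit propagator -/

/-- The periodised Biot–Savart LINE KERNEL of the family with streamwise wavenumber `a` and transverse Bloch
phase `β`: `G_{a,β}(y) = Σ_{n∈ℤ} e^{2πiβn} g(y - n)`, `g(y) = -e^{-κ|y|}/(2κ)`, `κ = 2π|a|`, in closed form on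
`y = ⌊y⌋ + r`: `e^{2πiβ⌊y⌋} · (-(e^{-κr}/(1 - e^{-2πiβ}e^{-κ}) + e^{κ(r-1)} e^{2πiβ}/(1 - e^{2πiβ}e^{-κ}))/(2κ))`.
(`-G_{a,β}(y₀ - y)` is the stream function at height `y₀` of the unit vorticity mode `e^{2πiax} δ(· - y)`;
junk at `a = 0`, where it is only ever multiplied by `a`.) -/
def lineKernel (a β y : ℝ) : ℂ :=
  let κ : ℝ := 2 * Real.pi * |a|
  let r : ℝ := y - (⌊y⌋ : ℝ)
  let z : ℂ := Complex.exp (2 * Real.pi * β * Complex.I)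
  Complex.exp (2 * Real.pi * β * (⌊y⌋ : ℝ) * Complex.I) *
    (-((Real.exp (-(κ * r)) : ℂ) / (1 - (starRingEnd ℂ z) * (Real.exp (-κ) : ℂ))
       + (Real.exp (κ * (r - 1)) : ℂ) * z / (1 - z * (Real.exp (-κ) : ℂ))) / (2 * κ : ℂ))

/-- Transport multiplier of an H slot of total strain `θ` on the streamwise mode `a`:
`e^{2πiax} ζ₀(y) ↦ e^{2πia(x - θ·triWave y)} ζ₀(y)`. -/
def transportPhase (a θ y : ℝ) : ℂ :=
  Complex.exp (-(2 * Real.pi * a * θ * triWave y : ℝ) * Complex.I)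

/-- The 2 × 2 Kelvin–Helmholtz block of the kink-sheet pair `(q₊ on y = 1/4, q₋ on y = -1/4)`:
`X = 2πia · [[-1/4 - 2G(0), -2G(1/2)], [2 conj G(1/2), 1/4 + 2G(0)]]`, `G = lineKernel a β`
(diagonal = transport of each sheet by the shear at its own line ± self/partner induction; the tree's
`khField k β` is `X` with `2πG(0) = Σ₀`, `2π conj G(1/2) = S`). -/
def blockX (a β : ℝ) : Matrix (Fin 2) (Fin 2) ℂ :=
  ((2 * Real.pi * a : ℝ) * Complex.I : ℂ) •
    !![-(1 / 4 : ℂ) - 2 * lineKernel a β 0, -2 * lineKernel a β (1 / 2);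
       2 * starRingEnd ℂ (lineKernel a β (1 / 2)), (1 / 4 : ℂ) + 2 * lineKernel a β 0]

/-- `λ(a, β) = -a²·c²(a, β)`: the common eigenvalue-square of the block, `X² = λ • 1` (`BlockSq`);
`λ > 0` unstable (rate `√λ = sawSigma a β`), `λ < 0` stable, `λ = 0` neutral. -/
def khLam (a β : ℝ) : ℝ := -(a ^ 2 * sawC2 a β)

/-- `C(t)`: `cosh(√λ t)` / `cos(√(-λ) t)` / `1`. -/
def propC (a β t : ℝ) : ℝ :=
  if 0 < khLam a β then Real.cosh (Real.sqrt (khLam a β) * t)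
  else if khLam a β < 0 then Real.cos (Real.sqrt (-(khLam a β)) * t) else 1

/-- `Sn(t)`: `sinh(√λ t)/√λ` / `sin(√(-λ) t)/√(-λ)` / `t`. -/
def propSn (a β t : ℝ) : ℝ :=
  if 0 < khLam a β then Real.sinh (Real.sqrt (khLam a β) * t) / Real.sqrt (khLam a β)
  else if khLam a β < 0 then Real.sin (Real.sqrt (-(khLam a β)) * t) / Real.sqrt (-(khLam a β)) else t

/-- The explicit propagator `P(t) = e^{tX} = C(t)·1 + Sn(t)·X` (p2 `sheet_solution_eq`; `det P = 1`). -/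
def propagator (a β t : ℝ) : Matrix (Fin 2) (Fin 2) ℂ :=
  ((propC a β t : ℝ) : ℂ) • (1 : Matrix (Fin 2) (Fin 2) ℂ) + ((propSn a β t : ℝ) : ℂ) • blockX a β

/-! ## 2. Lamination states, forcing, Duhamel, the slot map -/

/-- S-4 state of ONE line family: an interior density profile on the period `[-1/2, 1/2)` (quasi-periodic
continuation with Bloch phase `β` understood) plus finitely many vortex SHEETS `(position yᵢ ∈ [-1/2,1/2),
amplitude cᵢ)`, i.e. the transverse density `ζ₀(y) + Σᵢ cᵢ δ(y - yᵢ)` of the streamwise mode `e^{2πiax}`. -/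
structure LamState where
  interior : ℝ → ℂ
  sheets : List (ℝ × ℂ)

/-- The pure interior mode `ζ₀ ≡ 1` (the transverse mode `n = 0` when `β = 0`): the comb remnant of P3. -/
def pureMode : LamState := ⟨fun _ => 1, []⟩

/-- A bare sheet pair on the kink lines with amplitudes `(q₊, q₋)` and no interior content. -/
def sheetPair (qp qm : ℂ) : LamState := ⟨fun _ => 0, [((1 / 4 : ℝ), qp), (-(1 / 4 : ℝ), qm)]⟩

/-- Forcing of the block at slot-time `s`: `f(s) = 2πia · (-2 ∫ G(1/4 - y) dμ_s(y), 2 ∫ G(-1/4 - y) dμ_s(y))`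
where `μ_s = transported state = (ζ₀(y) dy + Σ cᵢ δ_{yᵢ}) · e^{-2πias·triWave y}` — the transverse velocity the
transported content induces on the two kink lines, times the vorticity jump. -/
def forcing (a β : ℝ) (st : LamState) (s : ℝ) : Fin 2 → ℂ :=
  let src : ℝ → ℂ := fun y0 =>
    (∫ y in (-(1 / 2 : ℝ))..(1 / 2), lineKernel a β (y0 - y) * st.interior y * transportPhase a s y)
      + (st.sheets.map (fun p => lineKernel a β (y0 - p.1) * p.2 * transportPhase a s p.1)).sum
  ![((2 * Real.pi * a : ℝ) * Complex.I : ℂ) * (-2) * src (1 / 4),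
    ((2 * Real.pi * a : ℝ) * Complex.I : ℂ) * 2 * src (-(1 / 4))]

/-- Fresh sheet amplitudes after strain `θ` (Duhamel): `q(θ) = ∫₀^θ P(θ - s) f(s) ds`. -/
def sheetAmps (a β θ : ℝ) (st : LamState) : Fin 2 → ℂ :=
  ∫ s in (0 : ℝ)..θ, (propagator a β (θ - s)).mulVec (forcing a β st s)

/-- THE SLOT MAP on one line family (S-2): transported interior, transported old sheets, plus the fresh pair
`(1/4, q₊), (-1/4, q₋)`. -/
def slotMap (a β θ : ℝ) (st : LamState) : LamState :=
  ⟨fun y => st.interior y * transportPhase a θ y,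
   (st.sheets.map (fun p => (p.1, p.2 * transportPhase a θ p.1)))
     ++ [((1 / 4 : ℝ), sheetAmps a β θ st 0), (-(1 / 4 : ℝ), sheetAmps a β θ st 1)]⟩

/-! ## 3. Fourier coefficients and energy -/

/-- Transverse Fourier coefficient at `β + n`: `ζ̂(n) = ∫ ζ₀ e^{-2πi(β+n)y} dy + Σᵢ cᵢ e^{-2πi(β+n)yᵢ}`. -/
def coeff (β : ℝ) (st : LamState) (n : ℤ) : ℂ :=
  (∫ y in (-(1 / 2 : ℝ))..(1 / 2), st.interior y * Complex.exp (-(2 * Real.pi * (β + n) * y : ℝ) * Complex.I))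
    + (st.sheets.map (fun p => p.2 * Complex.exp (-(2 * Real.pi * (β + n) * p.1 : ℝ) * Complex.I))).sum

/-- Kinetic energy (velocity `L²` norm squared, up to the common factor) of the state on the family `(a, β)`:
`E = Σ_n |ζ̂(n)|² / (4π² (a² + (β + n)²))` (junk 0 if not summable; summable whenever the interior is
integrable, the coefficients being bounded and the weights `O(n⁻²)`). -/
def energy (a β : ℝ) (st : LamState) : ℝ :=
  ∑' n : ℤ, ‖coeff β st n‖ ^ 2 / (4 * Real.pi ^ 2 * (a ^ 2 + (β + n) ^ 2))

/-! ## 4. Statements (targets; nothing below is proved in this file) -/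

/-- Kernel ↔ tree, diagonal entry: `2π G_{a,β}(0) = Σ₀(a, β)` for `a > 0`. -/
def KernelAtZero : Prop :=
  ∀ a β : ℝ, 0 < a → (2 * Real.pi : ℂ) * lineKernel a β 0 = ((sawSigma0 a β : ℝ) : ℂ)

/-- Kernel ↔ tree, off-diagonal entry: `2π conj G_{a,β}(1/2) = S_β(a)` for `a > 0` (the tree's lattice sum
`Σ_m e^{2πiβm} G(π + 2πm)` uses the opposite Bloch sign, whence the conjugate). -/
def KernelAtHalf : Prop :=
  ∀ a β : ℝ, 0 < a → (2 * Real.pi : ℂ) * starRingEnd ℂ (lineKernel a β (1 / 2)) = sawS a β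

/-- `X² = λ • 1` with `λ = -a² c²(a,β)` (p2's `khBlock_sq` transported to these conventions). -/
def BlockSq : Prop :=
  ∀ a β : ℝ, 0 < a → blockX a β * blockX a β = ((khLam a β : ℝ) : ℂ) • (1 : Matrix (Fin 2) (Fin 2) ℂ)

/-- The propagator solves the block ODE: `P(0) = 1`, `d/dt P(t) = X · P(t)`. -/
def PropagatorODE : Prop :=
  ∀ a β : ℝ, 0 < a → propagator a β 0 = 1 ∧
    ∀ t : ℝ, HasDerivAt (fun s => propagator a β s) (blockX a β * propagator a β t) t

/-- ONE-FAMILY SLOT NORM: on the family `(a, β)` a slot of strain `θ` amplifies the energy of every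
(integrable) lamination state by at most `B²`. -/
def SlotEnergyAmp (a β θ B : ℝ) : Prop :=
  ∀ st : LamState, IntervalIntegrable st.interior volume (-(1 / 2 : ℝ)) (1 / 2) →
    (∀ p ∈ st.sheets, p.1 ∈ Set.Ico (-(1 / 2 : ℝ)) (1 / 2)) →
    energy a β (slotMap a β θ st) ≤ B ^ 2 * energy a β st

/-- The arbiter's S2-cert object "slot norm ≤ B for the class `(α, β)`": energy is additive over the families
`a = α + m` and the slot is block-diagonal over them, so the class-level slot norm is the sup over `m`. -/
def SlotNormClass (α β θ B : ℝ) : Prop :=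
  ∀ m : ℤ, SlotEnergyAmp (α + m) β θ B

/-- Memo §3 **P3** (the two-level comb event): the pure comb mode `(a, β+n) = (1/2, 0)` drives the resonant
kink pair for one slot of strain 8; energy amplification `≤ B²`.  Measured continuum value of the amplitude
`14.436 ± 0.006` (kit j320829; K = 32 lattice value 14.347 = WO-3), so `CombEventP3 14.45` is the conjecture
and `CombEventP3 14.43` should be false. -/
def CombEventP3 (B : ℝ) : Prop :=
  energy (1 / 2) 0 (slotMap (1 / 2) 0 8 pureMode) ≤ B ^ 2 * energy (1 / 2) 0 pureMode

/-- Memo §2 G pattern (a fresh pair entering the NEXT slot, of the other orientation), for ONE streamwise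
wavenumber `a = α + m` of the pair's density: the H-sheet pair `(q₊ δ(y-1/4) + q₋ δ(y+1/4)) e^{2πiax}` is, for
the V slot, interior content `x ↦ c_n e^{2πiax}` with `c_n = q₊ e^{-iπ(β+n)/2} + q₋ e^{iπ(β+n)/2}` on each
transposed family (streamwise wavenumber `b = β + n`, transverse Bloch phase `α`, transverse mode `m`); the
V slot acts on each by `slotMap b α θ`, and the statement bounds total energy out by `B²` × total energy in.
Measured sup over `(q₊, q₋)` and KH-band `a`: ≤ 13.58 (83 classes, K = 24; K = 32 agrees), so `B = 13.6`–`14`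
is the conjecture for `|a| < 0.64`; for `|a|` up to `K` the sup reaches 16.2 (creation dominates) while pure
transport of such densities can refocus ×5.7 in amplitude (Orr). -/
def FreshPairNextSlotAmp (α β : ℝ) (m : ℤ) (θ B : ℝ) : Prop :=
  ∀ qp qm : ℂ,
    let c : ℤ → ℂ := fun n =>
      qp * Complex.exp (-(Real.pi * (β + n) / 2 : ℝ) * Complex.I)
        + qm * Complex.exp ((Real.pi * (β + n) / 2 : ℝ) * Complex.I)
    let st : ℤ → LamState := fun n =>
      ⟨fun x => c n * Complex.exp ((2 * Real.pi * (α + m) * x : ℝ) * Complex.I), []⟩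
    (∑' n : ℤ, energy (β + n) α (slotMap (β + n) α θ (st n)))
      ≤ B ^ 2 * ∑' n : ℤ, energy (β + n) α (st n)

end

end Summit.AnomalousDissipation.AnomalousDissipation.Cruxes.K1LocalisedCascade.K2SlotMap
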